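import Mathlib
import Summits.Ventures.PercRepro2.SLevelRegime

/-!
# (CD) — the covariance-monotone form of the (J1) line, at `S`-level (blind cell PercRepro2, mine-c g12;
MINE-C.md §19; INBOX 2026-08-25T00:52Z)

Reveal `S = C(a₁)` under `Q = {a₁ ↮ a₂}` (typer-1's `SLevel` objects: `covS F G = P(Q)² Cov_{S∼Q}(F, G)`
cleared, `phi S = D·1[a₃ ∈ S]·(h_o(S) − γ)` the jump functional, `hS x S = P_{G∖S}(x ∈ C(a₂))`, `indS x S = 1[x ∈ S]`).

**(CD)**: `Cov_{S∼Q}(F, φ) ≤ 0` for EVERY increasing function `F` of the revealed cluster — «`φ` is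
covariance-decreasing under the `Q`-law of `C₁`» although it is not pointwise decreasing (the jump at
`a₃ ∉ S → a₃ ∈ S` may be upward: `h_o(S) > γ` on a third of the case-1 clusters at `n = 5`).
One statement, a definition only (CANDIDATE: census n = 5 all graphs × markings × 4 palettes and n = 6
FULL × 2 palettes, the Strassen form checked by an exact max-flow per instance, 0 violations; exhaustive
binary-extreme n = 6 m ≤ 10 bar = kit j230617), from which the line's statements follow by INSTANTIATION:
* `F = indS b` gives **(i)** at `S`-level (`covS_indS_phi_nonpos_of_cd`; `covS_indS_phi_eq` is its table form);
* `F = 1 − hS b` (increasing, `hS b` antitone) gives **(SC)** `0 ≤ covS h_b φ` (`covS_hS_phi_nonneg_of_cd`),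
  hence **(ii) = (RV)** in table form (`rvTable_of_cd`, via typer-1's `rvTable_of_covS_nonneg`) and
  `J1RV.RV` (`rv_of_cd`);
* the pointwise regime `D·h_o(W) ≤ D_o` on `{W ∋ a₃}` implies (CD) (`cd_of_regime`: `−φ` is then
  increasing and nonnegative, BHK06 Thm 1.3 on `C₁`, `covS_nonneg_of_monotone`); (CD) is the statement
  that survives OUTSIDE the regime, where the regime theorems `covS_indS_phi_nonpos_of_regime` /
  `covS_hS_phi_nonneg_of_regime` do not apply;
* every up-set `𝓤` of vertex sets gives the per-up-set form `covS 1_𝓤 φ ≤ 0` (`cd_upset`).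
The pair form (CD*) — `F(C₁, C₂)` increasing in `C₁` and decreasing in `C₂`, the order of BHK06 Thm 1.5 —
follows from (CD) by Harris given `C₁` (the step by which BHK derive 1.5 from 1.3) and is not typed here.
Nothing about (CD) itself is claimed. -/

namespace Summit.Ventures.PercRepro2

open UnionCluster

namespace SLevel

section CD

variable {V : Type*} {E : Type*} [Fintype E] [DecidableEq E] [Fintype V] [DecidableEq V]
  {R : Type*} [Field R] [LinearOrder R] [IsStrictOrderedRing R]

variable (p : E → R) (ends : E → Sym2 V) (o a₁ a₂ a₃ b : V)

local notation3 "Q" => avoidAll ends a₂ {a₁}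
local notation3 "𝟙Q" => (avoidAll ends a₂ {a₁}).indicator (1 : Config E → R)
local notation3 "D" => prob p (PDEvent ends a₁ a₂ a₃)
local notation3 "Dₒ" => CovForm.Do p ends o a₁ a₂ a₃

/-- **(CD)**: the jump functional `φ(S) = D·1[a₃ ∈ S]·(h_o(S) − γ)` is covariance-decreasing under the
`Q`-law of the revealed cluster `C₁`: `covS F φ ≤ 0` (i.e. `Cov_{S∼Q}(F, φ) ≤ 0`) for every increasing
`F : Set V → R`. A definition only (mine-c g12 candidate; MINE-C.md §19). -/
def CD : Prop :=
  ∀ F : Set V → R, Monotone F → covS p ends a₁ a₂ F (phi p ends o a₁ a₂ a₃) ≤ 0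

omit [Fintype V] [DecidableEq V] [LinearOrder R] [IsStrictOrderedRing R] in
/-- `covS` is invariant under subtracting a constant from its first argument. -/
lemma covS_sub_const_left (F G : Set V → R) (c : R) :
    covS p ends a₁ a₂ (fun W => F W - c) G = covS p ends a₁ a₂ F G := by
  unfold covS
  have e1 : expect p (fun ω => (F (cluster ends ω a₁) - c) * G (cluster ends ω a₁) * 𝟙Q ω) =
      expect p (fun ω => F (cluster ends ω a₁) * G (cluster ends ω a₁) * 𝟙Q ω) -
        c * expect p (fun ω => G (cluster ends ω a₁) * 𝟙Q ω) := by
    rw [← expect_const_mul, ← expect_sub]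
    congr 1; funext ω; simp only [Pi.sub_apply]; ring
  have e2 : expect p (fun ω => (F (cluster ends ω a₁) - c) * 𝟙Q ω) =
      expect p (fun ω => F (cluster ends ω a₁) * 𝟙Q ω) - c * prob p Q := by
    rw [prob_eq_expect_indicator, ← expect_const_mul, ← expect_sub]
    congr 1; funext ω; simp only [Pi.sub_apply]; ring
  rw [e1, e2]
  ring

/-- **The pointwise regime implies (CD)**: if `D·h_o(W) ≤ D_o` on every `W ∋ a₃`, then `−φ` is
increasing and nonnegative, and BHK06 Thm 1.3 on `C₁` (`covS_nonneg_of_monotone`, after centring `F`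
at `F ∅ ≤ F W`) gives `covS F φ ≤ 0` for every increasing `F`. -/
theorem cd_of_regime (hp : IsProbVec p)
    (hreg : ∀ W : Set V, a₃ ∈ W → D * hS p ends a₂ o W ≤ Dₒ) : CD p ends o a₁ a₂ a₃ := by
  intro F hF
  have hF' : Monotone (fun W : Set V => F W - F ∅) := fun W W' h => by
    show F W - F ∅ ≤ F W' - F ∅
    linarith [hF h]
  have hF'0 : ∀ W : Set V, 0 ≤ F W - F ∅ := fun W => by
    linarith [hF (Set.empty_subset W)]
  have h := covS_nonneg_of_monotone p ends a₁ a₂ hp hF'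
    (neg_phi_monotone_of_regime p ends o a₁ a₂ a₃ hp hreg) hF'0
    (neg_phi_nonneg_of_regime p ends o a₁ a₂ a₃ hreg)
  rw [covS_neg_right, covS_sub_const_left] at h
  linarith

omit [Fintype V] [DecidableEq V] in
/-- **(CD) ⟹ (i) at `S`-level**: `covS (1[b ∈ ·]) φ ≤ 0` (`covS_indS_phi_eq` is its table form). -/
theorem covS_indS_phi_nonpos_of_cd (h : CD p ends o a₁ a₂ a₃) :
    covS p ends a₁ a₂ (indS b) (phi p ends o a₁ a₂ a₃) ≤ 0 :=
  h _ (indS_monotone b)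

omit [Fintype V] [DecidableEq V] in
/-- **(CD) ⟹ (SC)**: `0 ≤ covS h_b φ`, from the increasing function `1 − h_b` (`hS b` is antitone). -/
theorem covS_hS_phi_nonneg_of_cd (hp : IsProbVec p) (h : CD p ends o a₁ a₂ a₃) :
    0 ≤ covS p ends a₁ a₂ (hS p ends a₂ b) (phi p ends o a₁ a₂ a₃) := by
  have hgb : Antitone (hS p ends a₂ b) := delClusterProb_anti p hp ends a₂ (isUpperSet_mem_setOf b)
  have hF : Monotone (fun W : Set V => 1 - hS p ends a₂ b W) := fun W W' hWW' => by
    show 1 - hS p ends a₂ b W ≤ 1 - hS p ends a₂ b W'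
    linarith [hgb hWW']
  have h1 := h _ hF
  rw [covS_one_sub_left] at h1
  linarith

omit [DecidableEq V] in
/-- **(CD) ⟹ (ii) = (RV) in table form** (through (SC) and typer-1's `rvTable_of_covS_nonneg`). -/
theorem rvTable_of_cd (hp : IsProbVec p) (h : CD p ends o a₁ a₂ a₃) :
    J1RV.RVTable p ends o a₁ a₂ a₃ b :=
  rvTable_of_covS_nonneg p ends o a₁ a₂ a₃ b hp (covS_hS_phi_nonneg_of_cd p ends o a₁ a₂ a₃ b hp h)

omit [DecidableEq V] in
/-- **(CD) ⟹ (RV)** (`J1RV.RV`, the statement of record of row 2′J1-RV). -/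
theorem rv_of_cd (hp : IsProbVec p) (h : CD p ends o a₁ a₂ a₃) : J1RV.RV p ends o a₁ a₂ a₃ b :=
  J1RV.rv_of_rvTable p hp ends o a₁ a₂ a₃ b (rvTable_of_cd p ends o a₁ a₂ a₃ b hp h)

omit [Fintype V] [DecidableEq V] in
/-- **(CD) for an up-set**: `covS 1_𝓤 φ ≤ 0` for every up-set `𝓤` of vertex sets (the per-up-set
form: conditioning on `C₁ ∈ 𝓤` can only lower the mean of `φ`). -/
theorem cd_upset (h : CD p ends o a₁ a₂ a₃) {𝓤 : Set (Set V)} (h𝓤 : IsUpperSet 𝓤) :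
    covS p ends a₁ a₂ (𝓤.indicator (1 : Set V → R)) (phi p ends o a₁ a₂ a₃) ≤ 0 :=
  h _ (monotone_indicator_one_of_isUpperSet h𝓤)

end CD

end SLevel

end Summit.Ventures.PercRepro2
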